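import Mathlib
import HarnessLib
import Literature.Combinatorics.SimpleGraph.GeneralizedLaplacianPerron
import Summits.HubbardSuperconductivity.HubbardSuperconductivity.Theorems.SoloBlindChargeSpectrum

/-!
# The endpoint of every sign-free floor is the top hop eigenvalue — unconditionally
# (Proposition 43, λ_max half: the Perron–Frobenius input discharged; generation 73)

Solo-blind programme `HubbardSuperconductivity`, generation 73.  `SoloBlindChargePerron`
(generation 72) proved the ENDPOINT OF EVERY SIGN-FREE FLOOR (Proposition 43 of the obstruction
paper, §5.20(19)) in the form `min_u max_v C_u(v) = μ = λ_max` CONDITIONALLY on a positive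
solution `φ ≫ 0` of the hop eigen-equation, and left "the EXISTENCE of a positive eigenvector for
the connected hop graph (Perron–Frobenius)" as the one input outside the kernel.  That input is
in the tree's Literature library (Godsil–Royle Thm 8.8.1 (a), symmetric case:
`Literature.Combinatorics.SimpleGraph.GeneralizedLaplacianPerron.exists_pos_eigenvector_of_adj_pos`;
Ding–Zhou Thm 2.1 (i): `Literature.LinearAlgebra.Matrix.exists_pos_eigenvector`), and this file
discharges it.

Setting (as in `SoloBlindReciprocalCharge` / `SoloBlindChargePerron`).  `V` a finite type with
decidable equality, `R` a symmetric decidable relation on `V` (the *hops*), the `0/1` *hop matrix*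
`A = Matrix.of (fun v w => if R v w then 1 else 0)` (real symmetric, `hopMatrix_isHermitian`),
its largest eigenvalue `λ_max(A) = topEigenvalue (hopMatrix_isHermitian R hR)` (the tree's
`Literature.LinearAlgebra.Matrix.topEigenvalue` = `max_i` of Mathlib's
`Matrix.IsHermitian.eigenvalues`; `topEigenvalue_eq_iSup` identifies it with the `⨆ i` of
`SoloBlindChargeSpectrum`), AM–GM admissible *weight schemes* `u` (`u v w ≥ 0`,
`u v w · u w v ≥ 1` on hops) and their *charges* `C_u(v) = Σ_{w : R v w} u v w`.

* `fromRel_connected` — if every two points are joined by an `R`-chain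
  (`Relation.ReflTransGen R`), the loopless symmetrisation `SimpleGraph.fromRel R` is connected;
  `hopMatrix_pos_of_adj` — the hop matrix is positive on its edges.
* `exists_pos_hopEigenvector` — CONNECTED CASE, Perron vector: a chain-connected symmetric hop
  relation on a nonempty finite type has `φ ≫ 0` with `Σ_{w : R v w} φ w = λ_max(A) φ v`.
* `perron_endpoint_of_connected` — hence `SoloBlindChargePerron.perron_endpoint` holds with NO
  hypothesis beyond symmetry and chain-connectedness, with `μ = λ_max(A)`: (a) every admissible
  scheme has some charge `≥ λ_max(A)`, (b) some admissible scheme has all charges `= λ_max(A)`,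
  (c) every real hop eigenvalue has `|ν| ≤ λ_max(A)`.  `min_u max_v C_u(v) = λ_max(A)`.
* GENERAL CASE (no connectedness): `exists_charge_ge_topEigenvalue` — (a) for every symmetric
  `R`; `abs_hopEigenvalue_le_topEigenvalue` — (c) for every symmetric `R` (`λ_max` of a
  nonnegative symmetric matrix is its spectral radius: `|ψᵀAψ| ≤ |ψ|ᵀA|ψ| ≤ λ_max ψᵀψ`);
  `exists_scheme_charge_lt` — (b) up to `ε`: for every `ε > 0` some reciprocal scheme has ALL
  charges `< λ_max(A) + ε` (the Perron scheme of the entrywise positive perturbation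
  `A + (ε/|V|)·J`, `J` the all-ones matrix, whose top eigenvalue is `≤ λ_max(A) + ε` by the
  Rayleigh bound and Cauchy–Schwarz `(Σ yᵢ)² ≤ |V| Σ yᵢ²`).  Hence, for EVERY symmetric hop
  relation, `inf_u max_v C_u(v) = λ_max(A)`, attained when the hop graph is connected.

Reading (paper §5.20(19), Proposition 43).  With `SoloBlindSignFreeFloorEndpoint` (generation 60:
`max_s C_u(s) ≥` mean degree) and `SoloBlindChargePerron` / `SoloBlindChargeSpectrum` (generation
72: `max_s C_u(s) ≥ λ_max(A_E)` for every admissible `u`), this file closes Proposition 43 in the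
kernel with no side condition: the best constant of any sign-free kinetic floor obtained by
reciprocal AM–GM on hole hops IS the hard-core-boson value `t·λ_max(A_E)` of the hop graph — as an
infimum for every hop relation, as a minimum for a connected one.  (Connectedness of the `E`-hole
configuration graph of the torus under single hops — unlabelled token sliding — is therefore no
longer needed for any stated claim.)

References: this work (obstruction paper §5.20(19)); Perron–Frobenius inputs by name from
`Literature/Combinatorics/SimpleGraph/GeneralizedLaplacianPerron.lean` [GodsilRoyle2001, Thm
8.8.1 (a)] and `Literature/LinearAlgebra/Matrix/PerronSymmetric.lean` [DingZhou2009, Thm 2.1].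
-/

namespace Summit.HubbardSuperconductivity.HubbardSuperconductivity.Theorems.PerronEndpoint

open Finset Matrix
open Summit.HubbardSuperconductivity.HubbardSuperconductivity.Theorems.ChargePerron
  (hopMatrix_mulVec_apply perron_endpoint perronScheme_nonneg perronScheme_reciprocal)
open Summit.HubbardSuperconductivity.HubbardSuperconductivity.Theorems.ChargeSpectrum
  (hopMatrix_isHermitian iSup_eigenvalues_le_charge)
open Literature.LinearAlgebra.Matrix (topEigenvalue eigenvalues_le_topEigenvalue
  exists_eigenvalues_eq_topEigenvalue dotProduct_mulVec_le dotProduct_mulVec_le_abs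
  exists_pos_eigenvector)
open Literature.Combinatorics.SimpleGraph.GeneralizedLaplacianPerron
  (exists_pos_eigenvector_of_adj_pos)

variable {V : Type*} [Fintype V] [DecidableEq V] (R : V → V → Prop) [DecidableRel R]

/-! ### The hop matrix as a weighted adjacency matrix of `SimpleGraph.fromRel R` -/

omit [Fintype V] [DecidableEq V] in
/-- The hop matrix is entrywise nonnegative. [this work] -/
theorem hopMatrix_nonneg (v w : V) :
    0 ≤ (Matrix.of fun v w : V => if R v w then (1 : ℝ) else 0) v w := by
  simp only [Matrix.of_apply]
  split_ifs <;> norm_num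

omit [Fintype V] [DecidableEq V] in
/-- For a symmetric relation the hop matrix is positive on the edges of the loopless
symmetrisation `SimpleGraph.fromRel R`. [this work] -/
theorem hopMatrix_pos_of_adj (hR : ∀ v w, R v w → R w v) {v w : V}
    (h : (SimpleGraph.fromRel R).Adj v w) :
    0 < (Matrix.of fun v w : V => if R v w then (1 : ℝ) else 0) v w := by
  obtain ⟨-, h' | h'⟩ := (SimpleGraph.fromRel_adj R v w).1 h
  · simp only [Matrix.of_apply, if_pos h']
    norm_num
  · simp only [Matrix.of_apply, if_pos (hR w v h')]
    norm_num

omit [Fintype V] [DecidableEq V] [DecidableRel R] in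
/-- Chain-connectedness of `R` (every two points joined by an `R`-chain) makes
`SimpleGraph.fromRel R` connected. [this work] -/
theorem fromRel_connected [Nonempty V] (hconn : ∀ v w, Relation.ReflTransGen R v w) :
    (SimpleGraph.fromRel R).Connected := by
  rw [SimpleGraph.connected_iff]
  refine ⟨fun v w => ?_, inferInstance⟩
  have key : ∀ {w}, Relation.ReflTransGen R v w → (SimpleGraph.fromRel R).Reachable v w := by
    intro w h
    induction h with
    | refl => exact SimpleGraph.Reachable.refl v
    | @tail b c _ hbc ih =>
        by_cases hbc' : b = c
        · exact hbc' ▸ ih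
        · exact ih.trans
            (SimpleGraph.Adj.reachable ((SimpleGraph.fromRel_adj R b c).2 ⟨hbc', Or.inl hbc⟩))
  exact key (hconn v w)

/-- `λ_max` of the hop matrix: the tree's `topEigenvalue` (`max_i`) is the `⨆ i` of
`SoloBlindChargeSpectrum`. [this work] -/
theorem topEigenvalue_eq_iSup [Nonempty V] (hR : ∀ v w, R v w → R w v) :
    topEigenvalue (hopMatrix_isHermitian R hR) =
      ⨆ i, (hopMatrix_isHermitian R hR).eigenvalues i := by
  unfold topEigenvalue
  exact Finset.sup'_univ_eq_ciSup _

/-! ### Connected case: the Perron vector of the hop graph and the exact endpoint -/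

/-- **Perron vector of a connected hop graph.** For a symmetric, chain-connected relation `R` on
a nonempty finite type there is `φ` with all entries positive solving the hop eigen-equation
`Σ_{w : R v w} φ w = λ_max(A) φ v` for every `v` (Godsil–Royle Thm 8.8.1 (a), symmetric case,
applied to the hop matrix as a weighted adjacency matrix of `SimpleGraph.fromRel R`).
[cite: GodsilRoyle2001, Thm 8.8.1 (a); this work] -/
theorem exists_pos_hopEigenvector [Nonempty V] (hR : ∀ v w, R v w → R w v)
    (hconn : ∀ v w, Relation.ReflTransGen R v w) :
    ∃ φ : V → ℝ, (∀ v, 0 < φ v) ∧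
      ∀ v, (∑ w, if R v w then φ w else 0) = topEigenvalue (hopMatrix_isHermitian R hR) * φ v := by
  obtain ⟨φ, hpos, heig⟩ := exists_pos_eigenvector_of_adj_pos (SimpleGraph.fromRel R)
    (hopMatrix_isHermitian R hR) (fromRel_connected R hconn) (hopMatrix_nonneg R)
    (fun v w h => hopMatrix_pos_of_adj R hR h)
  refine ⟨φ, hpos, fun v => ?_⟩
  rw [← hopMatrix_mulVec_apply R φ v, heig, Pi.smul_apply, smul_eq_mul]

/-- **Perron endpoint of the sign-free floors, unconditional (connected hop graph).**  For a
symmetric, chain-connected relation `R` on a nonempty finite type, with `λ_max(A)` the largest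
eigenvalue of its hop matrix:
(a) EVERY AM–GM admissible scheme `u` has some charge `C_u(v) ≥ λ_max(A)`;
(b) SOME admissible scheme has ALL charges equal to `λ_max(A)`;
(c) every real hop eigenvalue `ν` has `|ν| ≤ λ_max(A)`.
Hence `min_u max_v C_u(v) = λ_max(A)` — `SoloBlindChargePerron.perron_endpoint` with its
positive-eigenvector hypothesis discharged by `exists_pos_hopEigenvector`. [this work] -/
theorem perron_endpoint_of_connected [Nonempty V] (hR : ∀ v w, R v w → R w v)
    (hconn : ∀ v w, Relation.ReflTransGen R v w) :
    (∀ u : V → V → ℝ, (∀ v w, R v w → 0 ≤ u v w) → (∀ v w, R v w → 1 ≤ u v w * u w v) →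
        ∃ v, topEigenvalue (hopMatrix_isHermitian R hR) ≤ ∑ w, if R v w then u v w else 0) ∧
      (∃ u : V → V → ℝ, (∀ v w, 0 ≤ u v w) ∧ (∀ v w, 1 ≤ u v w * u w v) ∧
        ∀ v, (∑ w, if R v w then u v w else 0) = topEigenvalue (hopMatrix_isHermitian R hR)) ∧
      (∀ (ν : ℝ) (ψ : V → ℝ), (∃ v, ψ v ≠ 0) →
        (∀ v, (∑ w, if R v w then ψ w else 0) = ν * ψ v) →
          |ν| ≤ topEigenvalue (hopMatrix_isHermitian R hR)) := by
  obtain ⟨φ, hpos, heig⟩ := exists_pos_hopEigenvector R hR hconn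
  exact perron_endpoint R hR hpos heig

/-! ### General case (no connectedness): (a) and (c) exactly, (b) up to `ε` -/

/-- **(a) for every symmetric hop relation**: every AM–GM admissible scheme has some charge
`C_u(v) ≥ λ_max(A)` (`SoloBlindChargeSpectrum.iSup_eigenvalues_le_charge` in `topEigenvalue`
form). [this work] -/
theorem exists_charge_ge_topEigenvalue [Nonempty V] (hR : ∀ v w, R v w → R w v)
    (u : V → V → ℝ) (hu : ∀ v w, R v w → 0 ≤ u v w) (huu : ∀ v w, R v w → 1 ≤ u v w * u w v) :
    ∃ v, topEigenvalue (hopMatrix_isHermitian R hR) ≤ ∑ w, if R v w then u v w else 0 := by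
  rw [topEigenvalue_eq_iSup R hR]
  exact iSup_eigenvalues_le_charge R hR u hu huu

omit [DecidableEq V] in
/-- For an entrywise nonnegative matrix, `−xᵀAx ≤ |x|ᵀA|x|` (companion of the tree's
`dotProduct_mulVec_le_abs`, termwise `−ab ≤ |a||b|`). [this work] -/
theorem neg_dotProduct_mulVec_le_abs {A : Matrix V V ℝ} (hA0 : ∀ i j, 0 ≤ A i j) (x : V → ℝ) :
    -(x ⬝ᵥ (A *ᵥ x)) ≤ (fun i => |x i|) ⬝ᵥ (A *ᵥ fun i => |x i|) := by
  simp only [dotProduct, mulVec, mul_sum]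
  rw [← sum_neg_distrib]
  refine sum_le_sum fun i _ => ?_
  rw [← sum_neg_distrib]
  refine sum_le_sum fun j _ => ?_
  calc -(x i * (A i j * x j)) = A i j * (-(x i * x j)) := by ring
    _ ≤ A i j * (|x i| * |x j|) := by
        refine mul_le_mul_of_nonneg_left ?_ (hA0 i j)
        rw [← abs_mul]
        exact neg_le_abs _
    _ = |x i| * (A i j * |x j|) := by ring

/-- **(c) for every symmetric hop relation**: every real hop eigenvalue `ν` (with a nonzero real
eigenvector) has `|ν| ≤ λ_max(A)` — the largest eigenvalue of the nonnegative symmetric hop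
matrix is its spectral radius (`±ψᵀAψ ≤ |ψ|ᵀA|ψ| ≤ λ_max |ψ|ᵀ|ψ| = λ_max ψᵀψ`). [this work] -/
theorem abs_hopEigenvalue_le_topEigenvalue [Nonempty V] (hR : ∀ v w, R v w → R w v)
    {ν : ℝ} {ψ : V → ℝ} (hψ : ∃ v, ψ v ≠ 0)
    (hν : ∀ v, (∑ w, if R v w then ψ w else 0) = ν * ψ v) :
    |ν| ≤ topEigenvalue (hopMatrix_isHermitian R hR) := by
  set A : Matrix V V ℝ := Matrix.of fun v w : V => if R v w then (1 : ℝ) else 0 with hAdef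
  have hA : A.IsHermitian := hopMatrix_isHermitian R hR
  have hAψ : A *ᵥ ψ = ν • ψ := by
    funext v
    rw [hAdef, hopMatrix_mulVec_apply R ψ v, hν v, Pi.smul_apply, smul_eq_mul]
  have hq : ψ ⬝ᵥ (A *ᵥ ψ) = ν * (ψ ⬝ᵥ ψ) := by
    rw [hAψ, dotProduct_smul, smul_eq_mul]
  obtain ⟨v₀, hv₀⟩ := hψ
  have hT : 0 < ψ ⬝ᵥ ψ := by
    have h1 : ψ ⬝ᵥ ψ = ∑ v, ψ v ^ 2 := by
      simp only [dotProduct, pow_two]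
    rw [h1]
    exact lt_of_lt_of_le (by positivity : (0 : ℝ) < ψ v₀ ^ 2)
      (Finset.single_le_sum (fun v _ => sq_nonneg (ψ v)) (Finset.mem_univ v₀))
  have habs : (fun i => |ψ i|) ⬝ᵥ (fun i => |ψ i|) = ψ ⬝ᵥ ψ := by
    simp only [dotProduct, abs_mul_abs_self]
  have h2 : (fun i => |ψ i|) ⬝ᵥ (A *ᵥ fun i => |ψ i|) ≤
      topEigenvalue hA * (ψ ⬝ᵥ ψ) := by
    have h := dotProduct_mulVec_le hA (fun i => |ψ i|)
    rwa [habs] at h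
  have hup : ψ ⬝ᵥ (A *ᵥ ψ) ≤ (fun i => |ψ i|) ⬝ᵥ (A *ᵥ fun i => |ψ i|) :=
    dotProduct_mulVec_le_abs (fun i j => hopMatrix_nonneg R i j) ψ
  have hdown : -(ψ ⬝ᵥ (A *ᵥ ψ)) ≤ (fun i => |ψ i|) ⬝ᵥ (A *ᵥ fun i => |ψ i|) :=
    neg_dotProduct_mulVec_le_abs (fun i j => hopMatrix_nonneg R i j) ψ
  rw [hq] at hup hdown
  rw [abs_le]
  constructor
  · have h3 : -ν * (ψ ⬝ᵥ ψ) ≤ topEigenvalue hA * (ψ ⬝ᵥ ψ) := by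
      rw [neg_mul]
      exact hdown.trans h2
    have h4 := le_of_mul_le_mul_right h3 hT
    linarith
  · exact le_of_mul_le_mul_right (hup.trans h2) hT

/-- The top eigenvalue of the entrywise positive perturbation `A + c·J` (`J` the all-ones matrix,
`c ≥ 0`) is at most `λ_max(A) + c·|V|`: at a top eigenvector `y` of `A + cJ`,
`λ_max(A + cJ) yᵀy = yᵀAy + c (Σ yᵢ)² ≤ λ_max(A) yᵀy + c |V| yᵀy` (Rayleigh bound for `A` and
Cauchy–Schwarz). [this work] -/
theorem topEigenvalue_add_const_le [Nonempty V] {A : Matrix V V ℝ} (hA : A.IsHermitian)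
    {c : ℝ} (hc : 0 ≤ c) (hAc : (A + Matrix.of fun _ _ : V => c).IsHermitian) :
    topEigenvalue hAc ≤ topEigenvalue hA + c * Fintype.card V := by
  obtain ⟨i₀, hi₀⟩ := exists_eigenvalues_eq_topEigenvalue hAc
  set y : V → ℝ := (hAc.eigenvectorBasis i₀).ofLp with hy
  have hy0 : y ≠ 0 :=
    (WithLp.ofLp_eq_zero 2).ne.2 (hAc.eigenvectorBasis.orthonormal.ne_zero i₀)
  have heig : (A + Matrix.of fun _ _ : V => c) *ᵥ y = topEigenvalue hAc • y := by
    rw [hy, hAc.mulVec_eigenvectorBasis i₀, hi₀]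
  -- the quadratic form of `A + cJ` at `y`
  have hJ : ∀ v, ((Matrix.of fun _ _ : V => c) *ᵥ y) v = c * ∑ w, y w := by
    intro v
    simp only [mulVec, dotProduct, Matrix.of_apply, Finset.mul_sum]
  have hsplit : y ⬝ᵥ ((A + Matrix.of fun _ _ : V => c) *ᵥ y) =
      y ⬝ᵥ (A *ᵥ y) + c * (∑ w, y w) ^ 2 := by
    rw [add_mulVec, dotProduct_add]
    congr 1
    have h1 : y ⬝ᵥ ((Matrix.of fun _ _ : V => c) *ᵥ y) = ∑ v, y v * (c * ∑ w, y w) := by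
      simp only [dotProduct, hJ]
    rw [h1, ← Finset.sum_mul, pow_two]
    ring
  have hq : y ⬝ᵥ ((A + Matrix.of fun _ _ : V => c) *ᵥ y) = topEigenvalue hAc * (y ⬝ᵥ y) := by
    rw [heig, dotProduct_smul, smul_eq_mul]
  -- `yᵀy > 0`
  obtain ⟨v₀, hv₀⟩ := Function.ne_iff.1 hy0
  have hv₀' : y v₀ ≠ 0 := fun h => hv₀ (by rw [h, Pi.zero_apply])
  have hyy : y ⬝ᵥ y = ∑ v, y v ^ 2 := by
    simp only [dotProduct, pow_two]
  have hT : 0 < y ⬝ᵥ y := by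
    rw [hyy]
    exact lt_of_lt_of_le (by positivity : (0 : ℝ) < y v₀ ^ 2)
      (Finset.single_le_sum (fun v _ => sq_nonneg (y v)) (Finset.mem_univ v₀))
  -- Rayleigh for `A`, Cauchy–Schwarz for `J`
  have hR' : y ⬝ᵥ (A *ᵥ y) ≤ topEigenvalue hA * (y ⬝ᵥ y) := dotProduct_mulVec_le hA y
  have hCS : (∑ w, y w) ^ 2 ≤ (Fintype.card V : ℝ) * (y ⬝ᵥ y) := by
    have h := Finset.sum_mul_sq_le_sq_mul_sq (Finset.univ : Finset V) y (fun _ => (1 : ℝ))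
    simp only [mul_one, one_pow, Finset.sum_const, Finset.card_univ, nsmul_eq_mul] at h
    rw [hyy, mul_comm]
    exact h
  have hmain : topEigenvalue hAc * (y ⬝ᵥ y) ≤
      (topEigenvalue hA + c * Fintype.card V) * (y ⬝ᵥ y) := by
    rw [← hq, hsplit, add_mul, mul_assoc]
    exact add_le_add hR' (mul_le_mul_of_nonneg_left hCS hc)
  exact le_of_mul_le_mul_right hmain hT

/-- **(b) up to `ε` for every symmetric hop relation**: for every `ε > 0` some reciprocal
(`u v w · u w v = 1`, nonnegative) scheme has ALL charges `< λ_max(A) + ε`.  It is the Perron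
scheme `u v w = φ w / φ v` of the Perron vector `φ ≫ 0` of the entrywise positive matrix
`A + (ε/|V|)·J` (Ding–Zhou Thm 2.1 (i)): its charges are
`λ_max(A + (ε/|V|)J) − (ε/|V|)(Σ φ)/φ v < λ_max(A + (ε/|V|)J) ≤ λ_max(A) + ε`
(`topEigenvalue_add_const_le`).  With (a): `inf_u max_v C_u(v) = λ_max(A)` for EVERY symmetric
hop relation. [cite: DingZhou2009, Thm 2.1 (i); this work] -/
theorem exists_scheme_charge_lt [Nonempty V] (hR : ∀ v w, R v w → R w v) {ε : ℝ} (hε : 0 < ε) :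
    ∃ u : V → V → ℝ, (∀ v w, 0 ≤ u v w) ∧ (∀ v w, 1 ≤ u v w * u w v) ∧
      ∀ v, (∑ w, if R v w then u v w else 0) < topEigenvalue (hopMatrix_isHermitian R hR) + ε := by
  set A : Matrix V V ℝ := Matrix.of fun v w : V => if R v w then (1 : ℝ) else 0 with hAdef
  have hA : A.IsHermitian := hopMatrix_isHermitian R hR
  have hcard : (0 : ℝ) < Fintype.card V := by exact_mod_cast Fintype.card_pos
  set c : ℝ := ε / Fintype.card V with hcdef
  have hc : 0 < c := div_pos hε hcard
  -- the perturbed matrix is symmetric with positive entries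
  have hAc : (A + Matrix.of fun _ _ : V => c).IsHermitian := by
    refine Matrix.IsHermitian.add hA (Matrix.IsHermitian.ext fun i j => ?_)
    simp only [Matrix.of_apply, star_trivial]
  have hposAc : ∀ i j, 0 < (A + Matrix.of fun _ _ : V => c) i j := by
    intro i j
    rw [Matrix.add_apply, Matrix.of_apply]
    exact add_pos_of_nonneg_of_pos (hopMatrix_nonneg R i j) hc
  obtain ⟨φ, hpos, heig⟩ := exists_pos_eigenvector hAc hposAc
  -- the hop eigen-sum at `φ`: `Σ_{w : R v w} φ w = λ_max(A + cJ) φ v − c Σ φ`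
  have hsum : ∀ v, (∑ w, if R v w then φ w else 0) =
      topEigenvalue hAc * φ v - c * ∑ w, φ w := by
    intro v
    have h1 : ((A + Matrix.of fun _ _ : V => c) *ᵥ φ) v =
        (∑ w, if R v w then φ w else 0) + c * ∑ w, φ w := by
      rw [add_mulVec, Pi.add_apply, hAdef, hopMatrix_mulVec_apply R φ v]
      congr 1
      simp only [mulVec, dotProduct, Matrix.of_apply, Finset.mul_sum]
    have h2 : ((A + Matrix.of fun _ _ : V => c) *ᵥ φ) v = topEigenvalue hAc * φ v := by
      rw [heig, Pi.smul_apply, smul_eq_mul]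
    linarith
  have hS : 0 < ∑ w, φ w := Finset.sum_pos (fun w _ => hpos w) Finset.univ_nonempty
  have htop : topEigenvalue hAc ≤ topEigenvalue hA + c * Fintype.card V :=
    topEigenvalue_add_const_le hA hc.le hAc
  have hcn : c * Fintype.card V = ε := by
    rw [hcdef, div_mul_cancel₀ _ hcard.ne']
  refine ⟨fun v w => φ w / φ v, fun v w => perronScheme_nonneg hpos v w,
    fun v w => perronScheme_reciprocal hpos v w, fun v => ?_⟩
  have hch : (∑ w, if R v w then φ w / φ v else 0) = (∑ w, if R v w then φ w else 0) / φ v := by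
    rw [Finset.sum_div]
    refine Finset.sum_congr rfl fun w _ => ?_
    split_ifs <;> simp
  rw [hch, hsum v, div_lt_iff₀ (hpos v)]
  have h3 : 0 < c * ∑ w, φ w := mul_pos hc hS
  have h4 : topEigenvalue hAc * φ v ≤ (topEigenvalue hA + ε) * φ v := by
    rw [← hcn]
    exact mul_le_mul_of_nonneg_right htop (hpos v).le
  linarith

/-- **The endpoint, packaged for every symmetric hop relation.**  On a nonempty finite type, for
a symmetric relation `R` with hop matrix `A` and `λ_max = topEigenvalue (hopMatrix_isHermitian R hR)`:
(a) every AM–GM admissible scheme has some charge `≥ λ_max`; (b_ε) for every `ε > 0` some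
reciprocal scheme has all charges `< λ_max + ε`; (c) every real hop eigenvalue has `|ν| ≤ λ_max`.
So `inf_u max_v C_u(v) = λ_max(A)` with no hypothesis on `R` beyond symmetry (and `= min` when
`R` is chain-connected, `perron_endpoint_of_connected`). [this work] -/
theorem floor_endpoint [Nonempty V] (hR : ∀ v w, R v w → R w v) :
    (∀ u : V → V → ℝ, (∀ v w, R v w → 0 ≤ u v w) → (∀ v w, R v w → 1 ≤ u v w * u w v) →
        ∃ v, topEigenvalue (hopMatrix_isHermitian R hR) ≤ ∑ w, if R v w then u v w else 0) ∧
      (∀ ε : ℝ, 0 < ε → ∃ u : V → V → ℝ, (∀ v w, 0 ≤ u v w) ∧ (∀ v w, 1 ≤ u v w * u w v) ∧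
        ∀ v, (∑ w, if R v w then u v w else 0) < topEigenvalue (hopMatrix_isHermitian R hR) + ε) ∧
      (∀ (ν : ℝ) (ψ : V → ℝ), (∃ v, ψ v ≠ 0) →
        (∀ v, (∑ w, if R v w then ψ w else 0) = ν * ψ v) →
          |ν| ≤ topEigenvalue (hopMatrix_isHermitian R hR)) :=
  ⟨fun u hu huu => exists_charge_ge_topEigenvalue R hR u hu huu,
    fun _ hε => exists_scheme_charge_lt R hR hε,
    fun _ _ hψ hν => abs_hopEigenvalue_le_topEigenvalue R hR hψ hν⟩

end Summit.HubbardSuperconductivity.HubbardSuperconductivity.Theorems.PerronEndpoint
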